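import Literature.Barriers.CriticalPhenomena.LongRangeTrivialityOnZ3WickReduction
import Literature.Probability.LatticeModels.AizenmanWickBoundProofs
import Literature.Barriers.CriticalPhenomena.LongRangeTrivialityOnZ3TreeDiagram
import Literature.Barriers.CriticalPhenomena.LongRangeTrivialityOnZ3InfraredBoundHolds

/-!
# Discharge of named literature fact(s) by composition

This file only composes reductions and discharges that are already in the tree
(no new definitions, no new named facts): each `theorem X_holds : X` below feeds the
proved hypotheses into an existing reduction theorem.  Net effect: the listed facts
stop being literature debt.
-/

namespace Literature.Barriers.CriticalPhenomena

/-- Discharge of `aizenman_pairInteraction_wickDeviation_le_finite` from Aizenman's proved Wick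
bound `aizenman_wickDeviation_le_finite_holds` via
`aizenman_pairInteraction_wickDeviation_le_finite_of_unit`.
[cite: AizenmanCMP1982, Prop. 12.1, eq. (12.3)] [cite: Panis2023Triviality, Prop. 4.6 with §4 (finite Λ) and Lemma 4.4] -/
theorem aizenman_pairInteraction_wickDeviation_le_finite_holds :
    aizenman_pairInteraction_wickDeviation_le_finite :=
  aizenman_pairInteraction_wickDeviation_le_finite_of_unit
    Literature.Probability.LatticeModels.aizenman_wickDeviation_le_finite_holds

/-- Discharge of `panis_evenMoment_deviation_le_wick` from Aizenman's proved Wick bound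
`aizenman_wickDeviation_le_finite_holds` via `panis_evenMoment_deviation_le_wick_of_unit`.
[cite: Panis2023Triviality, proof of Theorem 5.5, first display (p. 21), from Proposition 4.6] -/
theorem panis_evenMoment_deviation_le_wick_holds : panis_evenMoment_deviation_le_wick :=
  panis_evenMoment_deviation_le_wick_of_unit
    Literature.Probability.LatticeModels.aizenman_wickDeviation_le_finite_holds

/-- Discharge of `panis_thm12_dim3` (Panis, Thm. 1.2 in `d = 3`) from the proved Wick bound,
tree-diagram bound and algebraic infrared bound via `panis_thm12_dim3_of_unitWick`.
[cite: Panis2023Triviality, Theorem 1.2 (d = 3)] -/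
theorem panis_thm12_dim3_holds : panis_thm12_dim3 :=
  panis_thm12_dim3_of_unitWick
    Literature.Probability.LatticeModels.aizenman_wickDeviation_le_finite_holds
    panis_treeDiagramBound_holds panis_infraredBound_algebraic_holds

end Literature.Barriers.CriticalPhenomena
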